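/-
Copyright (c) 2026. All rights reserved.
Released under Apache 2.0 license as described in the file LICENSE.
-/
import Literature.Geometry.Kaehler.ComplexTorusQuaternionXSixKRYDegreeFormula
import Literature.Geometry.Kaehler.ComplexTorusQuaternionXSixSpecialCyclesDegreeBounds
import HarnessLib

/-!
# `Z(t) ≠ ∅ ⟺ χ_d(2) ≠ 1 ∧ χ_d(3) ≠ 1`: Kudla–Rapoport–Yang's Prop. 3.4.5 on `X₆` in Kronecker-symbol form

Eighth file of the Eichler-count plan. With `|L(t)/O₆^×| = (1 − χ₈(d_K))(1 − (d_K∕3))·Σ_{c ∣ F, (c,6)=1} h(c²d_K)`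
(`…XSixEichlerClassNumberFormula`) and `h(c²d_K) ≥ 1` (`BinQF.classNumber_pos`), the special cycle `Z(t)` of `X₆` is
non-empty — equivalently `|L(t)/O₆^×| > 0`, equivalently `deg Z(t)_ℚ > 0` — iff `δ(d; 6) ≠ 0`, i.e. iff NEITHER `2` NOR `3`
SPLITS in `k_t = ℚ(√−t)`: `χ₈(d_K) ≠ 1 ∧ (d_K∕3) ≠ 1` ([KRY] Prop. 3.4.5: `k_t` embeds in `B` iff the primes of `D(B)`
do not split in `k_t`). The series proved the same non-vanishing with the ELEMENTARY criterion
`¬(t = 9ᵏu, u ≡ 2 (3) ∨ t = 4ᵏu, u ≡ 7 (8))` (`…ClassCount.card_unit_classes_pos_iff`, `…DegreeBounds.degree_pos_iff`); §2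
records the equivalence of the two criteria.

* §1 `sum_classNumber_pos`, **`card_unit_classes_pos_iff_kronecker`**, `card_unit_classes_eq_zero_iff_kronecker`,
  `degree_pos_iff_kronecker`.
* §2 `kronecker_criterion_iff_elementary`.

## Sources

* [KRY] S. Kudla, M. Rapoport, T. Yang (2006), §3.4 Prop. 3.4.5 and (3.4.4)–(3.4.6). [cite: KudlaRapoportYang2006, §3.4 Prop. 3.4.5]
* M.-F. Vignéras, LNM 800 (1980), Ch. III §3 Thm. 3.8, §5 Cor. 5.12–5.14. [cite: VignerasLNM800, Ch. III §3 Thm. 3.8]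
* D. A. Cox (2013), Thm. 2.8 (`h(D) ≥ 1`), §7.D (Kronecker symbol and splitting). [cite: Cox2013, Thm. 2.8, §7.D]

## Scope (honest)

Theorems only — no definition, no named fact, no instance.
-/

set_option maxSynthPendingDepth 3

open Quaternion Function
open scoped Pointwise
open Literature.NumberTheory.Automorphic Literature.NumberTheory.Automorphic.Brandt
open Literature.NumberTheory.Automorphic.HeckeTraceFormulaGL2Level (ellipticConductors)
open Literature.NumberTheory.QuadraticFields.Quadratic (BinQF.classNumber BinQF.classNumber_pos)

namespace Literature.Geometry.Kaehler.ComplexTorus.QuaternionType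

/-! ## §1 The Kronecker criterion -/

section Kronecker

/-- `Σ_{c ∣ F, (c,6)=1} h(c²d_K) ≥ h(d_K) ≥ 1`. [cite: Cox2013, Thm. 2.8] -/
theorem sum_classNumber_pos {m : ℕ} (hm : 0 < m) :
    0 < ∑ c ∈ ((conductor 0 m).divisors.filter fun c : ℕ => c.Coprime 6), (BinQF.classNumber (((c : ℕ) : ℤ) ^ 2 * (tOf 0 m (conductor 0 m) ^ 2 - 4 * nOf 0 m (conductor 0 m))) : ℤ) := by
  have h1 : 1 ∈ ((conductor 0 m).divisors.filter fun c : ℕ => c.Coprime 6) := by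
    rw [Finset.mem_filter, Nat.mem_divisors]
    exact ⟨⟨one_dvd _, (conductor_pos (show (0 : ℤ) ^ 2 < 4 * m by positivity)).ne'⟩, Nat.coprime_one_left 6⟩
  rw [← Finset.add_sum_erase _ _ h1]
  have hpos : 0 < BinQF.classNumber (((1 : ℕ) : ℤ) ^ 2 * (tOf 0 m (conductor 0 m) ^ 2 - 4 * nOf 0 m (conductor 0 m))) := by
    rw [Nat.cast_one, one_pow, one_mul]
    exact BinQF.classNumber_pos (by have := disc_conductor_le hm; omega) (disc_conductor_emod_four hm)
  have hnn : 0 ≤ ∑ c ∈ (((conductor 0 m).divisors.filter fun c : ℕ => c.Coprime 6)).erase 1, (BinQF.classNumber (((c : ℕ) : ℤ) ^ 2 * (tOf 0 m (conductor 0 m) ^ 2 - 4 * nOf 0 m (conductor 0 m))) : ℤ) :=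
    Finset.sum_nonneg fun _ _ => by positivity
  have : (0 : ℤ) < (BinQF.classNumber (((1 : ℕ) : ℤ) ^ 2 * (tOf 0 m (conductor 0 m) ^ 2 - 4 * nOf 0 m (conductor 0 m))) : ℤ) := by exact_mod_cast hpos
  omega

/-- `χ₈` takes the values `0, ±1`. [folklore] -/
private theorem χ₈_trichotomy₆₈ (x : ZMod 8) : ZMod.χ₈ x = 0 ∨ ZMod.χ₈ x = 1 ∨ ZMod.χ₈ x = -1 := by
  revert x; decide

/-- `(a∕3)` takes the values `0, ±1`. [folklore] -/
private theorem legendreSym_three_trichotomy₆₈ (a : ℤ) :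
    legendreSym 3 a = 0 ∨ legendreSym 3 a = 1 ∨ legendreSym 3 a = -1 := by
  rw [legendreSym]
  generalize (a : ZMod 3) = b
  revert b; decide

/-- **`|L(t)/O₆^×| > 0 ⟺ χ₈(d_K) ≠ 1 ∧ (d_K∕3) ≠ 1`** — KRY's index set (3.4.13) is non-empty iff neither `2` nor `3`
splits in `k_t = ℚ(√−t)`, i.e. iff `k_t` embeds in `B = (−1,3)_ℚ` (`δ(d; 6) ≠ 0`). [cite: KudlaRapoportYang2006, §3.4 Prop. 3.4.5] [cite: VignerasLNM800, Ch. III §3 Thm. 3.8] -/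
theorem card_unit_classes_pos_iff_kronecker {m : ℕ} (hm : 0 < m) :
    0 < Nat.card (Quot (fun x y : {x : ℤ × ℤ × ℤ // x.1 ^ 2 - 3 * x.2.1 ^ 2 - 3 * x.2.2 ^ 2 = (m : ℤ)} ↦
      ∃ v : ℍ[ℚ,((-1 : ℤ) : ℚ),((3 : ℤ) : ℚ)], (v ∈ order (-1) 3 ∨ v - ⟨1/2, 1/2, 1/2, -1/2⟩ ∈ order (-1) 3) ∧
        ((v * star v).re = 1 ∨ (v * star v).re = -1) ∧
        v * ⟨0, x.1.1, x.1.2.1, x.1.2.2⟩ = ⟨0, y.1.1, y.1.2.1, y.1.2.2⟩ * v)) ↔ ZMod.χ₈ ((((tOf 0 m (conductor 0 m) ^ 2 - 4 * nOf 0 m (conductor 0 m)) : ℤ)) : ZMod 8) ≠ 1 ∧ legendreSym 3 (tOf 0 m (conductor 0 m) ^ 2 - 4 * nOf 0 m (conductor 0 m)) ≠ 1 := by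
  have h := card_unit_classes_eq_kronecker_mul_sum_classNumber hm
  have hS := sum_classNumber_pos hm
  constructor
  · intro hpos
    have hne : (Nat.card (Quot (fun x y : {x : ℤ × ℤ × ℤ // x.1 ^ 2 - 3 * x.2.1 ^ 2 - 3 * x.2.2 ^ 2 = (m : ℤ)} ↦
      ∃ v : ℍ[ℚ,((-1 : ℤ) : ℚ),((3 : ℤ) : ℚ)], (v ∈ order (-1) 3 ∨ v - ⟨1/2, 1/2, 1/2, -1/2⟩ ∈ order (-1) 3) ∧
        ((v * star v).re = 1 ∨ (v * star v).re = -1) ∧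
        v * ⟨0, x.1.1, x.1.2.1, x.1.2.2⟩ = ⟨0, y.1.1, y.1.2.1, y.1.2.2⟩ * v)) : ℤ) ≠ 0 := by exact_mod_cast hpos.ne'
    rw [h] at hne
    refine ⟨fun h2 => hne ?_, fun h3 => hne ?_⟩
    · rw [h2]; ring
    · rw [h3]; ring
  · rintro ⟨h2, h3⟩
    have hδ2 : 0 < 1 - ZMod.χ₈ ((((tOf 0 m (conductor 0 m) ^ 2 - 4 * nOf 0 m (conductor 0 m)) : ℤ)) : ZMod 8) := by
      rcases χ₈_trichotomy₆₈ ((((tOf 0 m (conductor 0 m) ^ 2 - 4 * nOf 0 m (conductor 0 m)) : ℤ)) : ZMod 8) with e | e | e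
      · rw [e]; norm_num
      · exact absurd e h2
      · rw [e]; norm_num
    have hδ3 : 0 < 1 - legendreSym 3 (tOf 0 m (conductor 0 m) ^ 2 - 4 * nOf 0 m (conductor 0 m)) := by
      rcases legendreSym_three_trichotomy₆₈ (tOf 0 m (conductor 0 m) ^ 2 - 4 * nOf 0 m (conductor 0 m)) with e | e | e
      · rw [e]; norm_num
      · exact absurd e h3
      · rw [e]; norm_num
    have : (0 : ℤ) < (Nat.card (Quot (fun x y : {x : ℤ × ℤ × ℤ // x.1 ^ 2 - 3 * x.2.1 ^ 2 - 3 * x.2.2 ^ 2 = (m : ℤ)} ↦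
      ∃ v : ℍ[ℚ,((-1 : ℤ) : ℚ),((3 : ℤ) : ℚ)], (v ∈ order (-1) 3 ∨ v - ⟨1/2, 1/2, 1/2, -1/2⟩ ∈ order (-1) 3) ∧
        ((v * star v).re = 1 ∨ (v * star v).re = -1) ∧
        v * ⟨0, x.1.1, x.1.2.1, x.1.2.2⟩ = ⟨0, y.1.1, y.1.2.1, y.1.2.2⟩ * v)) : ℤ) := by
      rw [h]; exact mul_pos (mul_pos hδ2 hδ3) hS
    exact_mod_cast this

/-- **`|L(t)/O₆^×| = 0 ⟺ χ₈(d_K) = 1 ∨ (d_K∕3) = 1`**: `Z(t) = ∅` iff `2` or `3` splits in `k_t`. [cite: KudlaRapoportYang2006, §3.4 Prop. 3.4.5] -/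
theorem card_unit_classes_eq_zero_iff_kronecker {m : ℕ} (hm : 0 < m) :
    Nat.card (Quot (fun x y : {x : ℤ × ℤ × ℤ // x.1 ^ 2 - 3 * x.2.1 ^ 2 - 3 * x.2.2 ^ 2 = (m : ℤ)} ↦
      ∃ v : ℍ[ℚ,((-1 : ℤ) : ℚ),((3 : ℤ) : ℚ)], (v ∈ order (-1) 3 ∨ v - ⟨1/2, 1/2, 1/2, -1/2⟩ ∈ order (-1) 3) ∧
        ((v * star v).re = 1 ∨ (v * star v).re = -1) ∧
        v * ⟨0, x.1.1, x.1.2.1, x.1.2.2⟩ = ⟨0, y.1.1, y.1.2.1, y.1.2.2⟩ * v)) = 0 ↔ ZMod.χ₈ ((((tOf 0 m (conductor 0 m) ^ 2 - 4 * nOf 0 m (conductor 0 m)) : ℤ)) : ZMod 8) = 1 ∨ legendreSym 3 (tOf 0 m (conductor 0 m) ^ 2 - 4 * nOf 0 m (conductor 0 m)) = 1 := by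
  have h := card_unit_classes_pos_iff_kronecker hm
  by_cases h0 : Nat.card (Quot (fun x y : {x : ℤ × ℤ × ℤ // x.1 ^ 2 - 3 * x.2.1 ^ 2 - 3 * x.2.2 ^ 2 = (m : ℤ)} ↦
      ∃ v : ℍ[ℚ,((-1 : ℤ) : ℚ),((3 : ℤ) : ℚ)], (v ∈ order (-1) 3 ∨ v - ⟨1/2, 1/2, 1/2, -1/2⟩ ∈ order (-1) 3) ∧
        ((v * star v).re = 1 ∨ (v * star v).re = -1) ∧
        v * ⟨0, x.1.1, x.1.2.1, x.1.2.2⟩ = ⟨0, y.1.1, y.1.2.1, y.1.2.2⟩ * v)) = 0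
  · rw [h0, lt_self_iff_false, false_iff, not_and_or, not_not, not_not] at h
    exact ⟨fun _ => h, fun _ => h0⟩
  · have hp : 0 < Nat.card (Quot (fun x y : {x : ℤ × ℤ × ℤ // x.1 ^ 2 - 3 * x.2.1 ^ 2 - 3 * x.2.2 ^ 2 = (m : ℤ)} ↦
      ∃ v : ℍ[ℚ,((-1 : ℤ) : ℚ),((3 : ℤ) : ℚ)], (v ∈ order (-1) 3 ∨ v - ⟨1/2, 1/2, 1/2, -1/2⟩ ∈ order (-1) 3) ∧
        ((v * star v).re = 1 ∨ (v * star v).re = -1) ∧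
        v * ⟨0, x.1.1, x.1.2.1, x.1.2.2⟩ = ⟨0, y.1.1, y.1.2.1, y.1.2.2⟩ * v)) := Nat.pos_of_ne_zero h0
    have h' := h.mp hp
    constructor
    · intro h00; exact absurd h00 h0
    · rintro (e | e)
      · exact absurd e h'.1
      · exact absurd e h'.2

/-- **`deg Z(t)_ℚ > 0 ⟺ χ₈(d_K) ≠ 1 ∧ (d_K∕3) ≠ 1`.** [cite: KudlaRapoportYang2006, §3.4 Prop. 3.4.5 and (3.4.4)] -/
theorem degree_pos_iff_kronecker {m : ℕ} (hm : 0 < m) :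
    0 < 2 * ∑ᶠ q : (Quot (fun x y : {x : ℤ × ℤ × ℤ // x.1 ^ 2 - 3 * x.2.1 ^ 2 - 3 * x.2.2 ^ 2 = (m : ℤ)} ↦
      ∃ v : ℍ[ℚ,((-1 : ℤ) : ℚ),((3 : ℤ) : ℚ)], (v ∈ order (-1) 3 ∨ v - ⟨1/2, 1/2, 1/2, -1/2⟩ ∈ order (-1) 3) ∧
        ((v * star v).re = 1 ∨ (v * star v).re = -1) ∧
        v * ⟨0, x.1.1, x.1.2.1, x.1.2.2⟩ = ⟨0, y.1.1, y.1.2.1, y.1.2.2⟩ * v)),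
        ((Nat.card
          {u : ℍ[ℚ,((-1 : ℤ) : ℚ),((3 : ℤ) : ℚ)] // (u ∈ order (-1) 3 ∨ u - ⟨1/2, 1/2, 1/2, -1/2⟩ ∈ order (-1) 3) ∧
            ((u * star u).re = 1 ∨ (u * star u).re = -1) ∧
            u * ⟨0, q.out.1.1, q.out.1.2.1, q.out.1.2.2⟩ = ⟨0, q.out.1.1, q.out.1.2.1, q.out.1.2.2⟩ * u} : ℚ))⁻¹ ↔ ZMod.χ₈ ((((tOf 0 m (conductor 0 m) ^ 2 - 4 * nOf 0 m (conductor 0 m)) : ℤ)) : ZMod 8) ≠ 1 ∧ legendreSym 3 (tOf 0 m (conductor 0 m) ^ 2 - 4 * nOf 0 m (conductor 0 m)) ≠ 1 := by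
  have ht : (0 : ℤ) < (m : ℤ) := by exact_mod_cast hm
  rw [degree_pos_iff ht, ← card_unit_classes_pos_iff ht, card_unit_classes_pos_iff_kronecker hm]

end Kronecker

/-! ## §2 The two criteria agree -/

section Elementary

/-- **The Kronecker criterion equals the elementary one**: `χ₈(d_K) ≠ 1 ∧ (d_K∕3) ≠ 1 ⟺
¬(t = 9ᵏ·u with u ≡ 2 (mod 3), or t = 4ᵏ·u with u ≡ 7 (mod 8))` — both say that neither `3` nor `2` splits in
`ℚ(√−t)`; obtained here by comparing the two descriptions of `|L(t)/O₆^×| > 0`. [cite: KudlaRapoportYang2006, §3.4 Prop. 3.4.5] [cite: Cox2013, §7.D (Kronecker symbol and splitting)] -/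
theorem kronecker_criterion_iff_elementary {m : ℕ} (hm : 0 < m) :
    (ZMod.χ₈ ((((tOf 0 m (conductor 0 m) ^ 2 - 4 * nOf 0 m (conductor 0 m)) : ℤ)) : ZMod 8) ≠ 1 ∧ legendreSym 3 (tOf 0 m (conductor 0 m) ^ 2 - 4 * nOf 0 m (conductor 0 m)) ≠ 1) ↔ ¬ ((∃ k : ℕ, ∃ u : ℤ, u % 3 = 2 ∧ (m : ℤ) = 9 ^ k * u) ∨ (∃ k : ℕ, ∃ u : ℤ, u % 8 = 7 ∧ (m : ℤ) = 4 ^ k * u)) := by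
  have ht : (0 : ℤ) < (m : ℤ) := by exact_mod_cast hm
  rw [← card_unit_classes_pos_iff_kronecker hm, card_unit_classes_pos_iff ht]

end Elementary

end Literature.Geometry.Kaehler.ComplexTorus.QuaternionType
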